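import Summits.HubbardSuperconductivity.HubbardSuperconductivity.Theorems.AnisotropyChordTowerIdentities

/-!
# Route `AnisotropyChord` / H0 rotor rung, route (1): the VARIATIONAL / TRANSPORT form of the tower-fidelity floor
# (theory seat `hubbard-h0-rotor-theory-1`, cycle 16, Part N17 §2–3, memo ROTOR-THEORY-16 §207; verbatim port)
(Verbatim port of the theory seat `hubbard-h0-rotor-theory-1` file `cycle16/lean/PartN17.lean §2–3`, sha16 57cb0e2b0f44fe8c, by the prover seat
`hubbard-h0-rotor-p1` g18: tree namespace, linter option and docstring tags only; no new mathematics.)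

Two elementary facts about the tower fidelity `towerFidelity b a = ⟨a, S⁺b⟩² / ‖S⁺b‖²` (for a unit `a`), which recast
the floor hypothesis `TowerFidelityFloor` (file `AnisotropyChordTransferFidelityFloor`) geometrically:

1. **VARIATIONAL FORM OF THE FLOOR (proved):** `one_sub_towerFidelity_le` — for a unit `a`,
   `1 − towerFidelity b a ≤ ‖a − c·S⁺b‖²` for EVERY real `c` (and `=` at the optimal `c`): the floor `F ≥ f₀` says
   exactly that `ψ_{j+1}` lies within `√(1 − f₀)` of the RAY of the tower state `S⁺ψ_j`.
2. **DEFECT–TRANSPORT BOUND (proved):** `one_sub_towerFidelity_le_planCost` — if `a = s · (K-weighted insertion of b)` for some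
   site-dependent insertion weights `K τ x` (a «plan»; by the adjacent-sector covering theorem
   `xxzAdjacentSectorCovering_holds` (file `AnisotropyChordAdjacentSectorCovering`) + Strassen a plan with `K ≥ 0`, unit row
   sums EXISTS), then for every `c`, `1 − F ≤ s² Σ_τ (S⁺b)(τ) Σ_{x particle of τ} b(τ∖x) (K τ x − c)²` (two Cauchy–Schwarz
   steps): a plan that is near-uniform in this weighted mean square gives the floor.  Numerics (kit j323720, memo §207): the
   POINTWISE spread `max K / min K` of the actual amplitude ratio diverges in `d = 1` and drifts in `d = 2` while `F` stays
   `0.92` / `0.993`: any proof of the floor is an `L²`-bulk statement, not a pointwise one.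

No definition is introduced (§1 of the theory file, the typed covering statement, is the landed theorem
`xxzAdjacentSectorCovering_holds` and is not duplicated here).
-/

set_option linter.dupNamespace false
set_option autoImplicit false

noncomputable section

open Finset
open Literature.MathematicalPhysics.QuantumLattice
open Summit.HubbardSuperconductivity.HubbardSuperconductivity.Theorems.AnisotropyChord.Tower

namespace Summit.HubbardSuperconductivity.HubbardSuperconductivity.Theorems.AnisotropyChord.Transfer

variable {V : Type} [Fintype V] [DecidableEq V]

/-! ## 1. Variational form of the tower-fidelity floor -/

/-- `Σ_σ (a σ − c · r σ)² = Σ a² − 2c Σ r a + c² Σ r²`. [folklore] -/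
private theorem sum_sub_mul_sq (a r : (V → Fin 2) → ℝ) (c : ℝ) :
    ∑ σ, (a σ - c * r σ) ^ 2 = ∑ σ, a σ ^ 2 - 2 * c * ∑ σ, r σ * a σ + c ^ 2 * ∑ σ, r σ ^ 2 := by
  simp only [Finset.mul_sum, ← Finset.sum_sub_distrib, ← Finset.sum_add_distrib]
  exact Finset.sum_congr rfl fun σ _ => by ring

/-- **VARIATIONAL FORM OF THE FLOOR.** For a unit vector `a` and every real `c`:
`1 − towerFidelity b a ≤ ‖a − c · S⁺b‖² = Σ_σ (a σ − c · raiseSum b σ)²` (equality at `c = ⟨a,S⁺b⟩/‖S⁺b‖²`).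
So `towerFidelity b a ≥ f₀` iff `a` is within `√(1 − f₀)` of the ray `ℝ · S⁺b`. [folklore] -/
theorem one_sub_towerFidelity_le (b a : (V → Fin 2) → ℝ) (ha : ∑ σ, a σ ^ 2 = 1) (c : ℝ) :
    1 - towerFidelity b a ≤ ∑ σ, (a σ - c * raiseSum b σ) ^ 2 := by
  rw [sum_sub_mul_sq, ha, towerFidelity, towerSum_eq_raise]
  unfold raiseNormSq
  set T := ∑ σ, raiseSum b σ * a σ with hT
  set R := ∑ σ, raiseSum b σ ^ 2 with hR
  have hR0 : 0 ≤ R := Finset.sum_nonneg fun σ _ => sq_nonneg _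
  rcases hR0.eq_or_lt with hR0 | hRpos
  · -- `S⁺b = 0`: then `T = 0` and both sides are `1`
    have hr : ∀ σ, raiseSum b σ = 0 := fun σ =>
      pow_eq_zero_iff (n := 2) (by norm_num) |>.mp
        ((Finset.sum_eq_zero_iff_of_nonneg fun σ _ => sq_nonneg (raiseSum b σ)).mp hR0.symm σ (mem_univ σ))
    have hT0 : T = 0 := by rw [hT]; exact Finset.sum_eq_zero fun σ _ => by rw [hr σ, zero_mul]
    rw [← hR0, hT0]; simp
  · have key : 2 * c * T - c ^ 2 * R ≤ T ^ 2 / R := by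
      rw [le_div_iff₀ hRpos]; nlinarith [sq_nonneg (T - c * R)]
    linarith

/-- The floor from ray-closeness: `‖a − c·S⁺b‖² ≤ ε ⇒ towerFidelity b a ≥ 1 − ε`. [folklore] -/
theorem towerFidelity_ge_of_near_ray (b a : (V → Fin 2) → ℝ) (ha : ∑ σ, a σ ^ 2 = 1) {c ε : ℝ}
    (h : ∑ σ, (a σ - c * raiseSum b σ) ^ 2 ≤ ε) : 1 - ε ≤ towerFidelity b a := by
  have := one_sub_towerFidelity_le b a ha c
  linarith

/-! ## 2. The defect–transport bound -/

/-- **DEFECT–TRANSPORT BOUND.** If the unit vector `a` is `s` times a `K`-WEIGHTED one-site insertion of `b ≥ 0`,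
`a τ = s · Σ_{x : τ x = 0} b(τ with x ↦ 1) · K τ x`, then for every real `c`
`1 − towerFidelity b a ≤ s² · Σ_τ (S⁺b)(τ) · Σ_{x : τ x = 0} b(τ with x ↦ 1) (K τ x − c)²`:
a plan that is near-constant in this weighted mean square yields the tower-fidelity floor (with `K ≡ c` the right side is `0`
and `F = 1`, the `Δ = 1` case).  By COV (+ Strassen) a plan with `K ≥ 0` and unit row sums exists for `|Δ| ≤ 1`.
(theory seat, cycle 16, memo ROTOR-THEORY-16 §207) [folklore] -/
theorem one_sub_towerFidelity_le_planCost (b a : (V → Fin 2) → ℝ) (hb : ∀ σ, 0 ≤ b σ) (ha : ∑ σ, a σ ^ 2 = 1)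
    (K : (V → Fin 2) → V → ℝ) (s c : ℝ)
    (hK : ∀ τ, a τ = s * ∑ x, if τ x = 0 then b (Function.update τ x 1) * K τ x else 0) :
    1 - towerFidelity b a ≤
      s ^ 2 * ∑ τ, raiseSum b τ * ∑ x, if τ x = 0 then b (Function.update τ x 1) * (K τ x - c) ^ 2 else 0 := by
  refine (one_sub_towerFidelity_le b a ha (s * c)).trans ?_
  rw [Finset.mul_sum]
  refine Finset.sum_le_sum fun τ _ => ?_
  -- per configuration: `(a τ − s c r τ)² = s² (Σ_x u_x v_x)² ≤ s² (Σ u)(Σ u v²)` with `u_x = [τ x = 0] b(τ∖x) ≥ 0`, `v_x = K − c`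
  set u : V → ℝ := fun x => if τ x = 0 then b (Function.update τ x 1) else 0 with hu
  have hu0 : ∀ x, 0 ≤ u x := fun x => by simp only [hu]; split_ifs <;> simp [hb]
  have hr : raiseSum b τ = ∑ x, u x := rfl
  have hdiff : a τ - s * c * raiseSum b τ = s * ∑ x, u x * (K τ x - c) := by
    rw [hK τ, hr, mul_assoc, ← mul_sub, Finset.mul_sum, ← Finset.sum_sub_distrib]
    congr 1
    refine Finset.sum_congr rfl fun x _ => ?_
    simp only [hu]; split_ifs <;> ring
  have hrhs : (∑ x, if τ x = 0 then b (Function.update τ x 1) * (K τ x - c) ^ 2 else 0)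
      = ∑ x, u x * (K τ x - c) ^ 2 :=
    Finset.sum_congr rfl fun x _ => by simp only [hu]; split_ifs <;> ring
  rw [hdiff, hrhs, mul_pow, hr]
  refine mul_le_mul_of_nonneg_left ?_ (sq_nonneg s)
  -- weighted Cauchy–Schwarz
  exact Finset.sum_sq_le_sum_mul_sum_of_sq_le_mul Finset.univ (fun x _ => hu0 x)
    (fun x _ => mul_nonneg (hu0 x) (sq_nonneg _)) (fun x _ => by ring_nf; exact le_rfl)

end Summit.HubbardSuperconductivity.HubbardSuperconductivity.Theorems.AnisotropyChord.Transfer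

end
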